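import Summits.Parity.GeneralizedHardyLittlewood.Theorems.FordMaynardSieveConst01651SieveConst01651LinePart08
import HarnessLib

/-!
# Route `FordMaynardSieveConst01651`, target `SieveConst01651` (stmt-Parity-19185): line `sieve_decomposition` re-homed — proofs, part 9 of 11 (file 10 of 12)

File 10 of 12 of the VERBATIM re-homing under `Theorems/` of the registered line skeleton
`Summits/Parity/GeneralizedHardyLittlewood/Cruxes/SieveConst01651/Lines/sieve_decomposition.lean` (v21, sha16
`ada6d0765119a11e`; author seat `linewriter-parity-smallroutes-1`, g0 v1–v20 / g1 v21): Ford–Maynard, Theorem 7.3 (a) at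
`P = (1/2, 0, ν)` with CLOSED support, cut along arXiv:2407.14368 §7.2 / §6.2, composed down to the route target
`Summit.Parity.GeneralizedHardyLittlewood.Theses.FordMaynardSieveConst01651.SieveConst01651`.  Namespace
`Summit.Parity.GeneralizedHardyLittlewood.FordMaynardSieveConst01651SieveDecomposition` (fresh; the `Cruxes` copy keeps its own), files of
≤ 400 lines chained by import; the three registered stubs are replaced by their landed proofs
(`…StubSignClauseFive` p834287, `…StubCertValuePos` p837763, `…TypeIIRegion` p833045), so the skeleton's composition
`SieveConst01651_of_stubs` (last part) is sorry-free.  Mathematics, statements and comments are the linewriter's; this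
re-homing (hand `leafhand-parity-fordmaynardsieveco-2` g4) only moved the definitions (`Eset`, `sliceTest`, `mainG1`, `vk`,
the `Signature.*` statement abbreviations, `Phi`, `innerI`, `jumpSet`, `gval`, `symmExt`, `idxProd`, `gam`) into the first
file, added docstrings where missing, and renamed two unused binders.
Declarations in this part: `injSumIntegral_of_tupleSum`, `measurable_hfun`, `c1_le_one`, `tupleSumIntegral_of_pieces`, `hk_pieces`, `tuple_sum_integral`, `injSum_integral`, `integrable_mainG1`, `primeTupleIntegral_mainG1_eq_slice`, `sliceIntegral_mainG1_eq`, `sliceIntegral_of_nonpos`, `primeTupleIntegral_mainG1_eq`, `chamber_symm`, `hfun_comp_cast`, `hfun_append_nil`, `Phi_perm`, `measurable_Phi`.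

References: [FordMaynard2024PrimeSieves] K. Ford, J. Maynard, *On the theory of prime producing sieves*, arXiv:2407.14368,
Theorem 7.3 (a), Proposition 7.19, §6.2, §7.2, §8.2.
-/

noncomputable section

open Finset
open Literature.NumberTheory.Sieve Literature.NumberTheory.Sieve.FordMaynard Literature.Barriers.Parity.FordMaynard
open Summit.Parity.GeneralizedHardyLittlewood.FordMaynardSieveConst01651SieveConst01651
  (hfun Admissible hfun_apply hfun_of_ne pvec roughPart smoothPart Gwt Hwt window IsRough Nset Rset mem_window mem_Nset mem_Rset
   coneCert openSmall stub_hkPieces stub_coneCertClosed_of_residues' coneCert_signClause_five_of_generic)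

namespace Summit.Parity.GeneralizedHardyLittlewood.FordMaynardSieveConst01651SieveDecomposition

/-- **Stub 1a from the full-tuple form**: the tuples with a repeated prime contribute `O(x^{1−ν/2})` (the … -/
theorem injSumIntegral_of_tupleSum (h : Signature.tupleSumIntegral) : Signature.injSumIntegral := by
  intro ν hν hν4 g hadm k hk hkK ε hε
  obtain ⟨d, rfl⟩ : ∃ d, k = d + 1 := ⟨k - 1, by omega⟩
  have hs : g.IsSymmetric := hadm.1
  have hν2 : 0 < ν / 2 := by positivity
  have hν21 : ν / 2 ≤ 1 := by linarith
  have hε2 : 0 < ε / 2 := by linarith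
  obtain ⟨x₀, hx₀⟩ := h ν hν hν4 g hadm (d + 1) hk hkK (ε / 2) hε2
  obtain ⟨Hb, hHb⟩ := exists_abs_hfun_le hs hadm.2.1 ν (d + 1)
  have hHb0 : 0 ≤ Hb := (abs_nonneg _).trans (hHb 0 fun i => i.elim0)
  obtain ⟨C, hC0, X, hX2, hcorner⟩ := exists_primeTupleSum_cornerInd_le (ν / 2) hν2 hν21 d
  set Lf : ℝ := Hb * ((d : ℝ) + 1) * ((d : ℝ) + 1 + ((1 : ℕ).primeFactors.card : ℝ)) with hLf
  have hLf0 : 0 ≤ Lf := by rw [hLf]; positivity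
  set c : ℝ := ε / (4 * (Lf * C + 1)) with hcdef
  have hLC0 : 0 ≤ Lf * C := mul_nonneg hLf0 hC0
  have hcpos : 0 < c := by rw [hcdef]; positivity
  have hev : ∀ᶠ x : ℝ in Filter.atTop, Real.log x ≤ c * x ^ (ν / 2) := by
    have hlo := (isLittleO_log_rpow_atTop hν2).def hcpos
    filter_upwards [hlo, Filter.eventually_ge_atTop (1 : ℝ)] with x hx hx1
    rw [Real.norm_eq_abs, Real.norm_eq_abs, abs_of_nonneg (Real.log_nonneg hx1),
      abs_of_nonneg (Real.rpow_nonneg (by linarith) _)] at hx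
    exact hx
  obtain ⟨N, hN⟩ := Filter.eventually_atTop.1 hev
  refine ⟨max (max x₀ X) (max 4 N), fun x hx => ?_⟩
  have hxx₀ : x₀ ≤ x := le_trans (le_trans (le_max_left _ _) (le_max_left _ _)) hx
  have hxX : X ≤ x := le_trans (le_trans (le_max_right _ _) (le_max_left _ _)) hx
  have hx4 : 4 ≤ x := le_trans (le_trans (le_max_left _ _) (le_max_right _ _)) hx
  have hxN : N ≤ x := le_trans (le_trans (le_max_right _ _) (le_max_right _ _)) hx
  have hlog := hN x hxN
  have hx1 : 1 ≤ x := by linarith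
  have hx0 : 0 < x := by linarith
  have hlogpos : 0 < Real.log x := Real.log_pos (by linarith)
  set c₁ : ℝ := Real.log ((⌊x⌋₊ : ℕ) : ℝ) / Real.log x with hc₁
  have hsupp : ∀ (K : ℕ) (v : Fin K → ℝ), hfun ν g (d + 1) K v ≠ 0 → ∀ i, ν ≤ v i :=
    fun K v hv => hfun_ne_zero_imp hv
  have hrep : |primeTupleSum (d + 1) x (mainG1 ν g (d + 1) x) - injSum (hfun ν g (d + 1)) x 1 ⌊x⌋₊ (d + 1)|
      ≤ Lf * primeTupleSum d x (cornerInd d (ν / 2) (c₁ - ν / 2)) := by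
    have := abs_primeTupleSum_sub_injSum_le (isSymmetric_hfun hs (d + 1)) hν hsupp hHb ⌊x⌋₊ (hrho_one hx4) hc₁ d
    rw [hLf]
    exact this
  have hfloor1 : (1 : ℝ) ≤ ((⌊x⌋₊ : ℕ) : ℝ) := by exact_mod_cast Nat.le_floor (by simpa using hx1)
  have hc₁le : c₁ ≤ 1 := by
    rw [hc₁, div_le_one hlogpos]
    exact Real.log_le_log (by linarith) (Nat.floor_le hx0.le)
  have hcor : primeTupleSum d x (cornerInd d (ν / 2) (c₁ - ν / 2)) ≤ C * (x ^ (1 - ν / 2) + 1) := by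
    have h1 := hcorner x hxX (c₁ - ν / 2) (by linarith)
    have h2 : x ^ (c₁ - ν / 2) ≤ x ^ (1 - ν / 2) := Real.rpow_le_rpow_of_exponent_le hx1 (by linarith)
    nlinarith
  have hpow : x ^ (1 - ν / 2) * x ^ (ν / 2) = x := by
    rw [← Real.rpow_add hx0]; norm_num
  have hsmall : x ^ (ν / 2) ≤ x := by
    have := Real.rpow_le_rpow_of_exponent_le hx1 hν21
    rwa [Real.rpow_one] at this
  have hkey : (x ^ (1 - ν / 2) + 1) * Real.log x ≤ 2 * c * x := by
    have hp0 : 0 ≤ x ^ (1 - ν / 2) := Real.rpow_nonneg hx0.le _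
    calc (x ^ (1 - ν / 2) + 1) * Real.log x ≤ (x ^ (1 - ν / 2) + 1) * (c * x ^ (ν / 2)) :=
          mul_le_mul_of_nonneg_left hlog (by positivity)
      _ = c * (x ^ (1 - ν / 2) * x ^ (ν / 2)) + c * x ^ (ν / 2) := by ring
      _ ≤ c * x + c * x := by rw [hpow]; exact add_le_add le_rfl (mul_le_mul_of_nonneg_left hsmall hcpos.le)
      _ = 2 * c * x := by ring
  have hcLC : 2 * c * (Lf * C) ≤ ε / 2 := by
    rw [hcdef]
    have h1 : Lf * C < Lf * C + 1 := by linarith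
    have h4 : 0 < 4 * (Lf * C + 1) := by positivity
    rw [show 2 * (ε / (4 * (Lf * C + 1))) * (Lf * C) = (ε / 2) * ((Lf * C) / (Lf * C + 1)) by field_simp; ring]
    have : (Lf * C) / (Lf * C + 1) ≤ 1 := by rw [div_le_one (by linarith)]; linarith
    calc ε / 2 * (Lf * C / (Lf * C + 1)) ≤ ε / 2 * 1 := mul_le_mul_of_nonneg_left this hε2.le
      _ = ε / 2 := mul_one _
  have hA : Lf * primeTupleSum d x (cornerInd d (ν / 2) (c₁ - ν / 2)) ≤ ε / 2 * x / Real.log x := by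
    rw [le_div_iff₀ hlogpos]
    calc Lf * primeTupleSum d x (cornerInd d (ν / 2) (c₁ - ν / 2)) * Real.log x
        ≤ Lf * (C * (x ^ (1 - ν / 2) + 1)) * Real.log x :=
          mul_le_mul_of_nonneg_right (mul_le_mul_of_nonneg_left hcor hLf0) hlogpos.le
      _ = (Lf * C) * ((x ^ (1 - ν / 2) + 1) * Real.log x) := by ring
      _ ≤ (Lf * C) * (2 * c * x) := mul_le_mul_of_nonneg_left hkey hLC0
      _ = (2 * c * (Lf * C)) * x := by ring
      _ ≤ (ε / 2) * x := mul_le_mul_of_nonneg_right hcLC hx0.le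
  have hB := hx₀ x hxx₀
  calc |injSum (hfun ν g (d + 1)) x 1 ⌊x⌋₊ (d + 1) - primeTupleIntegral (d + 1) x (mainG1 ν g (d + 1) x)|
      ≤ |injSum (hfun ν g (d + 1)) x 1 ⌊x⌋₊ (d + 1) - primeTupleSum (d + 1) x (mainG1 ν g (d + 1) x)|
          + |primeTupleSum (d + 1) x (mainG1 ν g (d + 1) x) - primeTupleIntegral (d + 1) x (mainG1 ν g (d + 1) x)| :=
        abs_sub_le _ _ _
    _ ≤ ε / 2 * x / Real.log x + ε / 2 * x / Real.log x := by
        refine add_le_add ?_ hB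
        rw [abs_sub_comm]
        exact hrep.trans hA
    _ = ε * x / Real.log x := by ring

/-- **`h_k = hfun ν g k` is measurable in every dimension** (the `hmeas` hypothesis of the tree's
`integrable_mainG_mul_tupleWeight`). -/
theorem measurable_hfun {g : VecFn} (hs : g.IsSymmetric) (hpc : IsPiecewiseConstOnCone g) (ν : ℝ) (k K : ℕ) :
    Measurable (hfun ν g k K) := by
  classical
  unfold hfun
  refine Measurable.ite ?_ (_root_.Summit.Parity.GeneralizedHardyLittlewood.FordMaynardSieveConst01651SieveConst01651.measurable_starSum_of_cone hs hpc K) measurable_const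
  have : {v : Fin K → ℝ | K = k ∧ ∀ i, ν < v i} = {v | K = k} ∩ ⋂ i, {v | ν < v i} := by
    ext v; simp [Set.mem_iInter]
  rw [this]
  exact (MeasurableSet.const _).inter (MeasurableSet.iInter fun i => measurableSet_lt measurable_const (measurable_pi_apply i))

/-- `c₁ = log ⌊x⌋ / log x ≤ 1` for `x > 1`. -/
theorem c1_le_one {x : ℝ} (hx : 1 < x) : Real.log ((⌊x⌋₊ : ℕ) : ℝ) / Real.log x ≤ 1 := by
  have hlogpos : 0 < Real.log x := Real.log_pos hx
  have hfloor1 : (1 : ℝ) ≤ ((⌊x⌋₊ : ℕ) : ℝ) := by exact_mod_cast Nat.le_floor (by simpa using hx.le)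
  rw [div_le_one hlogpos]
  exact Real.log_le_log (by linarith) (Nat.floor_le (by linarith))

open scoped Classical in
/-- **Stub 1a from the piece decomposition** (v20): ONE instantiation of the tree's `abs_primeTupleSum_mainG_sub_integral_le`
with `hF2 :=` the tree's prime-tuple PNT `exists_primeTupleSum_approx (ν/2) _ _ 2 k`; error `CF·Σ|c_j|·x^{c₁}/log² x ≤ εx/log x`. -/
theorem tupleSumIntegral_of_pieces (hP : Signature.stub_hkPieces) : Signature.tupleSumIntegral := by
  intro ν hν hν4 g hadm k hk hkν ε hε
  have hadm' := hadm
  obtain ⟨hs, hpc, -, -, -⟩ := hadm'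
  -- the pieces in dimension `t + k`
  obtain ⟨n, Pc, c, hPc, hsum⟩ := hP ν hν hν4 g hadm k ((1 : ℕ).primeFactors.card + k)
  -- the prime-tuple PNT on convex sets (tree, PROVED)
  obtain ⟨CF, hCF0, X, hX2, hF2⟩ :=
    exists_primeTupleSum_approx (ν / 2) (by positivity) (by linarith) 2 k
  set S : ℝ := ∑ j, |c j| with hSdef
  have hS0 : 0 ≤ S := Finset.sum_nonneg fun j _ => abs_nonneg _
  refine ⟨max (max X 4) (Real.exp (CF * S / ε)), fun x hx => ?_⟩
  have hxX : X ≤ x := le_trans (le_trans (le_max_left _ _) (le_max_left _ _)) hx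
  have hx4 : 4 ≤ x := le_trans (le_trans (le_max_right _ _) (le_max_left _ _)) hx
  have hexp : Real.exp (CF * S / ε) ≤ x := le_trans (le_max_right _ _) hx
  have hx1 : 1 < x := by linarith
  have hx0 : 0 < x := by linarith
  have hL : 0 < Real.log x := Real.log_pos hx1
  have hLε : CF * S / ε ≤ Real.log x := by
    have := Real.log_le_log (Real.exp_pos _) hexp
    rwa [Real.log_exp] at this
  -- hypotheses of the tree theorem
  have hsupp : ∀ (K : ℕ) (v : Fin K → ℝ), hfun ν g k K v ≠ 0 → ∀ i, ν ≤ v i :=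
    fun K v h => hfun_ne_zero_imp h
  have ht : (1 : ℕ).primeFactors.card = 0 := by rw [Nat.primeFactors_one, card_empty]
  have hu : ∀ i : Fin (1 : ℕ).primeFactors.card, |uvec x 1 i| ≤ 1 :=
    fun i => by exfalso; have hi := i.isLt; omega
  have hKM : ∀ j : Fin n, 0 ≤ (fun _ : Fin n => (0 : ℝ)) j ∧ 0 ≤ (fun j => |c j|) j :=
    fun j => ⟨le_rfl, abs_nonneg _⟩
  have hpc' : ∀ j : Fin n, Convex ℝ (Pc j) ∧ MeasurableSet (Pc j) ∧
      Measurable (fun v : Fin ((1 : ℕ).primeFactors.card + k) → ℝ => if v ∈ Pc j then c j else 0) ∧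
      (∀ v, v ∉ Pc j → (fun v : Fin ((1 : ℕ).primeFactors.card + k) → ℝ => if v ∈ Pc j then c j else 0) v = 0) ∧
      (∀ v ∈ Pc j, ∀ w ∈ Pc j,
        |(fun v : Fin ((1 : ℕ).primeFactors.card + k) → ℝ => if v ∈ Pc j then c j else 0) v -
          (fun v : Fin ((1 : ℕ).primeFactors.card + k) → ℝ => if v ∈ Pc j then c j else 0) w| ≤
          (fun _ : Fin n => (0 : ℝ)) j * ‖v - w‖) ∧
      ∀ v, |(fun v : Fin ((1 : ℕ).primeFactors.card + k) → ℝ => if v ∈ Pc j then c j else 0) v| ≤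
        (fun j => |c j|) j := by
    intro j
    refine ⟨(hPc j).1, (hPc j).2, ?_, ?_, ?_, ?_⟩
    · exact Measurable.ite (hPc j).2 measurable_const measurable_const
    · intro v hv; simp only [hv, if_false]
    · intro v hv w hw; simp only [hv, hw, if_true, sub_self, abs_zero, zero_mul, le_refl]
    · intro v
      by_cases hv : v ∈ Pc j
      · simp only [hv, if_true, le_refl]
      · simp only [hv, if_false, abs_zero, abs_nonneg]
  have hmain := abs_primeTupleSum_mainG_sub_integral_le (h := hfun ν g k) hν hsupp (s := k) (A := 2)
    (CF := CF) (X := X) (x := x) hF2 hxX hx1 (t := (1 : ℕ).primeFactors.card) (u := uvec x 1) hu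
    (c₀ := Real.log (x / (2 * ((1 : ℕ) : ℝ))) / Real.log x) (c₁ := Real.log ((⌊x⌋₊ : ℕ) : ℝ) / Real.log x)
    (c1_le_one hx1) (hrho_one hx4) hKM hpc' hsum
  -- the error bound
  have hx1le : x ^ (Real.log ((⌊x⌋₊ : ℕ) : ℝ) / Real.log x) ≤ x := by
    have := Real.rpow_le_rpow_of_exponent_le hx1.le (c1_le_one hx1)
    rwa [Real.rpow_one] at this
  have hsumK : (∑ j : Fin n, ((fun _ : Fin n => (0 : ℝ)) j * (8 * (k : ℝ) + 2) + (fun j => |c j|) j)) = S := by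
    rw [hSdef]; refine Finset.sum_congr rfl fun j _ => ?_; simp
  unfold mainG1
  refine hmain.trans ?_
  rw [hsumK]
  have hL2 : Real.log x ^ (2 : ℕ) = Real.log x * Real.log x := by ring
  rw [hL2]
  -- `CF * S * x^{c₁} / (log x * log x) ≤ ε * x / log x`
  rw [div_le_div_iff₀ (by positivity) hL]
  have hCS : CF * S ≤ ε * Real.log x := by
    have := (div_le_iff₀ hε).mp hLε
    linarith
  have hCS0 : 0 ≤ CF * S := mul_nonneg hCF0 hS0
  calc CF * S * x ^ (Real.log ((⌊x⌋₊ : ℕ) : ℝ) / Real.log x) * Real.log x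
      ≤ CF * S * x * Real.log x := by gcongr
    _ ≤ ε * Real.log x * x * Real.log x := by gcongr
    _ = ε * x * (Real.log x * Real.log x) := by ring

/-- **Stub 1a** (former stub; v21: the piece decomposition is the LANDED `…StubHkPieces.stub_hkPieces`, p828729, BY NAME). -/
theorem hk_pieces : Signature.stub_hkPieces := stub_hkPieces

/-- `tuple_sum_integral` — lemma of the line skeleton `sieve_decomposition` (v21, seat `linewriter-parity-smallroutes-1`), re-homed verbatim. [folklore] -/
theorem tuple_sum_integral : Signature.tupleSumIntegral := tupleSumIntegral_of_pieces hk_pieces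

/-- **Stub 1a, injective form** (former stub). -/
theorem injSum_integral : Signature.injSumIntegral := injSumIntegral_of_tupleSum tuple_sum_integral

/-- **`G_k · tupleWeight` is integrable and supported on positive vectors** (`x ≥ 4`; the tree's
`integrable_mainG_mul_tupleWeight` with … -/
theorem integrable_mainG1 {ν : ℝ} (hν : 0 < ν) {g : VecFn} (hs : g.IsSymmetric) (hpc : IsPiecewiseConstOnCone g) (k : ℕ)
    {x : ℝ} (hx : 4 ≤ x) :
    MeasureTheory.Integrable (fun y : Fin k → ℝ => mainG1 ν g k x y * tupleWeight x y) ∧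
      ∀ y : Fin k → ℝ, mainG1 ν g k x y * tupleWeight x y ≠ 0 → ∀ i, 0 < y i := by
  obtain ⟨Hb, hHb⟩ := exists_abs_hfun_le hs hpc ν k
  have hsupp : ∀ (K : ℕ) (v : Fin K → ℝ), hfun ν g k K v ≠ 0 → ∀ i, ν ≤ v i := fun K v hv => hfun_ne_zero_imp hv
  have hlc₀ : 0 < (∑ i, uvec x 1 i) + Real.log (x / (2 * ((1 : ℕ) : ℝ))) / Real.log x :=
    lt_of_lt_of_le (by norm_num) (hrho_one hx)
  exact integrable_mainG_mul_tupleWeight hν hsupp hHb (measurable_hfun hs hpc ν k) (by linarith : (1 : ℝ) < x)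
    (uvec x 1) (c1_le_one (x := x) (by linarith)) hlc₀ k

/-- **Stub 1b, step (iv) entry: the comparison integral sliced along `Σ y = w`** (the tree's
`integral_eq_integral_sliceIntegral`): … -/
theorem primeTupleIntegral_mainG1_eq_slice {ν : ℝ} (hν : 0 < ν) {g : VecFn} (hs : g.IsSymmetric)
    (hpc : IsPiecewiseConstOnCone g) (d : ℕ) {x : ℝ} (hx : 4 ≤ x) :
    primeTupleIntegral (d + 1) x (mainG1 ν g (d + 1) x)
      = ∫ w, sliceIntegral (d + 1) w (fun y => mainG1 ν g (d + 1) x y * tupleWeight x y) ∧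
    MeasureTheory.Integrable (fun w => sliceIntegral (d + 1) w (fun y => mainG1 ν g (d + 1) x y * tupleWeight x y)) := by
  obtain ⟨hint, hpos⟩ := integrable_mainG1 hν hs hpc (d + 1) hx
  exact integral_eq_integral_sliceIntegral hint hpos

/-- The slice in closed form for `0 < w` (the tree's `sliceIntegral_mainG` at `m = 1`, `t = 0`). -/
theorem sliceIntegral_mainG1_eq {ν : ℝ} {g : VecFn} (d : ℕ) {x : ℝ} (hx : 0 < x) {w : ℝ} (hw : 0 < w) :
    sliceIntegral (d + 1) w (fun y => mainG1 ν g (d + 1) x y * tupleWeight x y)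
      = if Real.log (x / (2 * ((1 : ℕ) : ℝ))) / Real.log x < w ∧ w ≤ Real.log ((⌊x⌋₊ : ℕ) : ℝ) / Real.log x then
          x ^ w / ((∑ i, uvec x 1 i) + w) * ((((d + 1).factorial : ℕ) : ℝ) *
            typeITerm (hfun ν g (d + 1)) (1 : ℕ).primeFactors.card (fun i => uvec x 1 i / ((∑ i, uvec x 1 i) + w)) (d + 1))
        else 0 := by
  have hsum : (∑ i, uvec x 1 i) = 0 := by
    have ht : (1 : ℕ).primeFactors.card = 0 := by rw [Nat.primeFactors_one, card_empty]
    exact sum_eq_zero fun i _ => by exfalso; have hi := i.isLt; omega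
  have hρ : 0 < (∑ i, uvec x 1 i) + w := by rw [hsum, zero_add]; exact hw
  exact sliceIntegral_mainG (hfun ν g (d + 1)) hx (uvec x 1) _ _ d w hρ

/-- `sliceIntegral_of_nonpos` — lemma of the line skeleton `sieve_decomposition` (v21, seat `linewriter-parity-smallroutes-1`), re-homed verbatim. [folklore] -/
theorem sliceIntegral_of_nonpos {d : ℕ} {w : ℝ} (hw : w ≤ 0) (G : (Fin (d + 1) → ℝ) → ℝ) :
    sliceIntegral (d + 1) w G = 0 := by
  show (∫ u : Fin d → ℝ, (if (∀ i, 0 < u i) ∧ ∑ i, u i < w then G (Fin.snoc u (w - ∑ i, u i)) else 0)) = 0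
  have : (fun u : Fin d → ℝ => (if (∀ i, 0 < u i) ∧ ∑ i, u i < w then G (Fin.snoc u (w - ∑ i, u i)) else 0))
      = fun _ => 0 := by
    funext u
    rw [if_neg]
    rintro ⟨hpos, hlt⟩
    have : 0 ≤ ∑ i, u i := sum_nonneg fun i _ => (hpos i).le
    linarith
  rw [this, MeasureTheory.integral_zero]

/-- **The comparison integral in closed form** (`x ≥ 4`): slicing along `Σ y = w` (tree: `integral_eq_integral_sliceIntegral`),
the slice in … -/
theorem primeTupleIntegral_mainG1_eq {ν : ℝ} (hν : 0 < ν) {g : VecFn} (hs : g.IsSymmetric) (hpc : IsPiecewiseConstOnCone g)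
    (d : ℕ) {x : ℝ} (hx : 4 ≤ x) :
    primeTupleIntegral (d + 1) x (mainG1 ν g (d + 1) x)
      = ((((d + 1).factorial : ℕ) : ℝ) * typeITerm (hfun ν g (d + 1)) (1 : ℕ).primeFactors.card (uvec x 1) (d + 1))
        * ∫ w in Set.Ioc (Real.log (x / (2 * ((1 : ℕ) : ℝ))) / Real.log x) (Real.log ((⌊x⌋₊ : ℕ) : ℝ) / Real.log x),
            x ^ w / w := by
  have hx0 : 0 < x := by linarith
  have ht : (1 : ℕ).primeFactors.card = 0 := by rw [Nat.primeFactors_one, card_empty]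
  have hsum : (∑ i, uvec x 1 i) = 0 := sum_eq_zero fun i _ => by exfalso; have hi := i.isLt; omega
  set c₀ : ℝ := Real.log (x / (2 * ((1 : ℕ) : ℝ))) / Real.log x with hc₀
  set c₁ : ℝ := Real.log ((⌊x⌋₊ : ℕ) : ℝ) / Real.log x with hc₁
  set J : ℝ := (((d + 1).factorial : ℕ) : ℝ) * typeITerm (hfun ν g (d + 1)) (1 : ℕ).primeFactors.card (uvec x 1) (d + 1)
    with hJ
  have hc₀pos : 0 < c₀ := by
    rw [hc₀, Nat.cast_one, mul_one]
    exact div_pos (Real.log_pos (by linarith)) (Real.log_pos (by linarith))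
  rw [(primeTupleIntegral_mainG1_eq_slice hν hs hpc d hx).1]
  have hslice : ∀ w, sliceIntegral (d + 1) w (fun y => mainG1 ν g (d + 1) x y * tupleWeight x y)
      = Set.indicator (Set.Ioc c₀ c₁) (fun w => x ^ w / w * J) w := by
    intro w
    rcases le_or_gt w 0 with hw | hw
    · rw [sliceIntegral_of_nonpos hw, Set.indicator_of_notMem]
      rw [Set.mem_Ioc]; rintro ⟨h1, -⟩; linarith
    · rw [sliceIntegral_mainG1_eq d hx0 hw]
      by_cases hmem : c₀ < w ∧ w ≤ c₁
      · rw [if_pos hmem, Set.indicator_of_mem (Set.mem_Ioc.2 hmem), hsum, zero_add, hJ]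
        have hξ : (fun i => uvec x 1 i / w) = uvec x 1 := funext fun i => by exfalso; have hi := i.isLt; omega
        rw [hξ]
      · rw [if_neg hmem, Set.indicator_of_notMem]; rwa [Set.mem_Ioc]
  simp_rw [hslice]
  rw [MeasureTheory.integral_indicator measurableSet_Ioc, MeasureTheory.integral_mul_const]
  ring

/-- **Stub 1b-β′** (former stub; PROVED in v19). -/
theorem chamber_symm : Signature.chamberSymm := _root_.Summit.Parity.GeneralizedHardyLittlewood.FordMaynardSieveConst01651SieveConst01651.chamber_symm'

/-- `h_k` on a cast vector. -/
theorem hfun_comp_cast {ν : ℝ} {g : VecFn} {k m : ℕ} (h : m = k) (u : Fin k → ℝ) :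
    hfun ν g k m (u ∘ Fin.cast h) = if ∀ i, ν < u i then starSum g k u else 0 := by
  subst h
  have hu : (u ∘ Fin.cast rfl) = u := funext fun i => rfl
  rw [hu]
  unfold hfun
  simp only [true_and]

/-- `h_k` on the empty append (`t = #primeFactors 1 = 0`). -/
theorem hfun_append_nil {ν : ℝ} {g : VecFn} {k t : ℕ} (ht : t = 0) (ξ : Fin t → ℝ) (u : Fin k → ℝ) :
    hfun ν g k (t + k) (Fin.append ξ u) = if ∀ i, ν < u i then starSum g k u else 0 := by
  rw [Fin.append_left_nil ξ u ht]
  exact hfun_comp_cast _ u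

/-- `Φ_k` is permutation invariant. -/
theorem Phi_perm {ν : ℝ} {g : VecFn} (hs : g.IsSymmetric) (k : ℕ) (σ : Equiv.Perm (Fin k)) (u : Fin k → ℝ) :
    Phi ν g k (u ∘ σ) = Phi ν g k u := by
  unfold Phi
  have h2 : ∏ i, (u ∘ σ) i = ∏ i, u i := Equiv.prod_comp σ u
  rw [_root_.Summit.Parity.GeneralizedHardyLittlewood.FordMaynardSieveConst01651SieveConst01651.starSum_perm' hs k σ u, h2]
  by_cases hall : ∀ i, ν < u i
  · have hall' : ∀ i, ν < (u ∘ σ) i := fun i => hall (σ i)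
    rw [if_pos hall', if_pos hall]
  · have hall' : ¬ ∀ i, ν < (u ∘ σ) i := fun h => hall fun j => by simpa using h (σ.symm j)
    rw [if_neg hall', if_neg hall]

/-- `Φ_k` is measurable. -/
theorem measurable_Phi {g : VecFn} (hs : g.IsSymmetric) (hpc : IsPiecewiseConstOnCone g) (ν : ℝ) (k : ℕ) :
    Measurable (Phi ν g k) := by
  unfold Phi
  refine Measurable.div (Measurable.ite ?_ (_root_.Summit.Parity.GeneralizedHardyLittlewood.FordMaynardSieveConst01651SieveConst01651.measurable_starSum_of_cone hs hpc k) measurable_const)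
    (Finset.measurable_prod (f := fun (i : Fin k) (u : Fin k → ℝ) => u i) univ fun i _ => measurable_pi_apply i)
  have : {u : Fin k → ℝ | ∀ i, ν < u i} = ⋂ i, {u | ν < u i} := by ext u; simp
  rw [this]
  exact MeasurableSet.iInter fun i => measurableSet_lt measurable_const (measurable_pi_apply i)

end Summit.Parity.GeneralizedHardyLittlewood.FordMaynardSieveConst01651SieveDecomposition

end
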